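import Literature.AlgebraicGeometry.Motives.HodgeTensor
import HarnessLib

/-!
# Tensor product of Hodge structures: separation of the filtration (proofs for `HodgeTensor`)

This file discharges the named fact `Literature.AlgebraicGeometry.Motives.HodgeStructure.exists_tensorFiltration_eq_bot` of
`Literature/AlgebraicGeometry/Motives/HodgeTensor.lean`: for pure `ℚ`-Hodge structures
`H₁ : HodgeStructure V n`, `H₂ : HodgeStructure W m`, the tensor-product filtration
`F^p (V ⊗ W) = Σ_{p ≤ a + b} F^a V ⊗ F^b W` (`HodgeStructure.tensorFiltration`, pulled back to
`ℂ ⊗ (V ⊗ W)` along `tensorBaseChange`) is **separated**: `F^p (V ⊗ W) = 0` for some `p`.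

Source: Deligne, *Théorie de Hodge II*, (1.1.12), p. 8: for objects `Aᵢ` "de filtration finie"
((1.1.4), p. 7: "Une filtration `F` de `A` est dite finie s'il existe `n` et `m` tels que
`Fⁿ(A) = A` et `Fᵐ(A) = 0`") and a right-exact multiadditive functor `⊗` one defines
"`Fᵏ(⊗ Aᵢ) = Σ_{Σ kᵢ = k} Im(⊗ F^{kᵢ}(Aᵢ) → ⊗ Aᵢ)` (somme de sous-objets)". That this filtration
is again finite is used tacitly there (and in (2.1.13) for Hodge structures); no proof is printed,
the remark being elementary. The vendored filtration uses `p ≤ a + b` instead of `a + b = k`, the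
same subspace for decreasing filtrations; the statement discharged is exactly the vendored one.

## Proof

Let `F^{a₀} V_ℂ = 0` and `F^{b₀} W_ℂ = 0` (separation of `H₁`, `H₂`). If `a₀ + b₀ ≤ a + b` then
`a₀ ≤ a` or `b₀ ≤ b`, so (filtrations being decreasing) `F^a V = 0` or `F^b W = 0`, and the summand
`im (F^a V ⊗ F^b W → V_ℂ ⊗ W_ℂ) = map₂ (· ⊗ ·) (F^a V) (F^b W)` (`TensorProduct.range_mapIncl`)
vanishes (`Submodule.map₂_bot_left` / `map₂_bot_right`). Hence every summand of
`F^{a₀+b₀}(V ⊗ W)` is the pull-back of `0` along the isomorphism `tensorBaseChange`, i.e. `0`.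
No flatness or finite-dimensionality is needed.

## Main results

* `Literature.HodgeStructure.exists_tensorFiltration_eq_bot_holds : exists_tensorFiltration_eq_bot`.

## References

* P. Deligne, *Théorie de Hodge. II*, Publ. Math. IHÉS 40 (1971), 5–57: (1.1.4) p. 7 (finite
  filtrations), (1.1.12) p. 8 (filtration on a tensor product), (2.1.13) (tensor product of Hodge
  structures).
-/

open scoped TensorProduct

noncomputable section

namespace Literature.AlgebraicGeometry.Motives

namespace HodgeStructure

universe u v

variable {V : Type u} [AddCommGroup V] [Module ℚ V]
variable {W : Type v} [AddCommGroup W] [Module ℚ W]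
variable {n m : ℤ}

/-- **Separation of the tensor filtration**, discharging the named fact
`exists_tensorFiltration_eq_bot`: if `F^{a₀} V_ℂ = 0` and `F^{b₀} W_ℂ = 0` then
`F^{a₀+b₀}(V ⊗ W) = 0`, since `a₀ + b₀ ≤ a + b` forces `a₀ ≤ a` or `b₀ ≤ b`, so every summand
`F^a V ⊗ F^b W` has a zero factor (Deligne, *Théorie de Hodge II*, (1.1.12), p. 8, with (1.1.4),
p. 7: the filtration `Fᵏ(⊗ Aᵢ) = Σ_{Σ kᵢ = k} Im(⊗ F^{kᵢ}(Aᵢ) → ⊗ Aᵢ)` of objects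
"de filtration finie"). [cite: DeligneHodgeII1971, (1.1.4) and (1.1.12), pp. 7–8] -/
theorem exists_tensorFiltration_eq_bot_holds :
    exists_tensorFiltration_eq_bot (V := V) (W := W) (n := n) (m := m) := by
  intro H₁ H₂
  obtain ⟨a₀, ha₀⟩ := H₁.exists_F_eq_bot
  obtain ⟨b₀, hb₀⟩ := H₂.exists_F_eq_bot
  refine ⟨a₀ + b₀, eq_bot_iff.2 (iSup₂_le fun a b => iSup_le fun hab => ?_)⟩
  have h : LinearMap.range (TensorProduct.mapIncl (H₁.F a) (H₂.F b)) = ⊥ := by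
    rw [TensorProduct.range_mapIncl]
    rcases le_or_gt a₀ a with ha | ha
    · rw [eq_bot_iff.2 ((H₁.antitone_F ha).trans_eq ha₀), Submodule.map₂_bot_left]
    · have hb : b₀ ≤ b := by omega
      rw [eq_bot_iff.2 ((H₂.antitone_F hb).trans_eq hb₀), Submodule.map₂_bot_right]
  rw [h, Submodule.comap_bot, LinearEquiv.ker]

end HodgeStructure

end Literature.AlgebraicGeometry.Motives

end
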